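/-
Copyright (c) 2026 the pub-hodgecm-mathlib formalisation cell (harness21).  Prover seat hodgecm-mathlib-R90-C10-p02 (g3), SLAB R90-TF, section S1 «Ch. 10∕12 local»
(base R90-C10); crux H413 = `stmt-HodgeConjecture-24833`; line (D-1) «B_pos at INERT places» of U4Keys :182 (S1 junction A2′), memo
`R90/R90-C10-p05/g2/DESIGN-Bpos-inert.md` f70d293d60bf8a4b; card (B-5z) «the `HE` discharge modulo the master» dealt BY NAME by R90-C10-plan (g2) 2026-09-05T00:35:59Z,
FILE A′ of its cut (the vanishing half of FILE A, split for the 400-line rule).  KERNEL module: THEOREMS ONLY (no definition, no named fact, no `sorry`, no instance, no notation).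
-/
import Summits.HodgeConjecture.HodgeConjecture.Theorems.R90S1BposPairIntegrandsTwoDepth     -- FILE A (this seat): §1 frame lemmas (`exists_eq_mul_of_ne_zero`, `lower_mem_map_conj(_model)`, `conj_mem_map_conj`, `mem_levelGroup_of_coe_eq_lower`), §2 `toFun_conj_weyl_eq_of_mem`; brings ★ (B-0), ★ (B-2b′), ★ (B-2b), ★ p862537, ★ `K2E3BranchBCellFunctionsCM`
import HarnessLib

/-!
# R90-TF · S1 «Ch10-local» ∕ K2 E3 «U4Keys» :182, BRANCH B AT POSITIVE DEPTH (inert) — brick (B-5z) FILE A′: THE FOUR CELL INTEGRANDS VANISH OFF THEIR CELLS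
# for a `(J_e, θ)`-eigen-section `f` of `i(χ₁, 1)` on `U(Φ₃)(L⁺_v)` and `u ∈ N(L⁺_v)`: `f(w₀u) = 0` off `J_e` if `f(1) = 0`, off the DEEP cell if `f(w₀) = 0`; `f(w₀uw₀) = 0` off the SHARP cell if
# `f(1) = 0`, off `J_e` if `f(w₀) = 0` — because every `(J_e, θ)`-type vector VANISHES on the intermediate cells `P·r·J_e` (★ (B-0), letters `R hR hwit` of ★ (B-2b″))
# [Casselman1995 Prop. 1.3.1, §6.3; Roche1998 §3–§4; Keys1984 §7 Thm (2); Rogawski1990 §1.10; BruhatTits1972 (4.4.4), (6.4.9)]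

Cell `pub/hodgecm-mathlib`, crux H413 = `stmt-HodgeConjecture-24833`, route of record `HCCMUnconditional` (no route verbs); R90-TF section S1 (junction socket A2′ = U4Keys :217, REL
over :155 and :182).  THEOREMS ONLY; lane `--supports stmt-HodgeConjecture-24833 --as helper`, count-neutral.  NOT THE PAYER of :182: with FILE A's values these four lemmas give the four
INTEGRANDS of the Casselman pair at `J_e` as indicators (`f_w(w₀u) = 𝟙[u ∈ J_e]`, `f₁(w₀u) = 𝟙[deep]·F₀`, `f_w(w₀uw₀) = 𝟙[sharp]·F₀`, `f₁(w₀uw₀) = 𝟙[w₀uw₀ ∈ J_e]`; memo (M12), (M11), (M22),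
(M21)), consumed by FILE B `R90S1BposPairEntriesOfMaster` (the entries from the master letter), which instantiates `HE` of ★ p863671 `R90S1KeysThmTwoPosDepthBranchBInertAllLeaf` §2.
FRAME = FILE A's: `(L v) (w hw) (eA heA) (ϖ hϖ)` + `(r₁ r₂ Jg hJg Je hJe)` (`e = (r₁, 0; r₂, 1)`) + `w₀` of matrix `Φ₃`; `θ(g) := if IsUnit g₀₀ then χ₁(unit g₀₀) else 0`; `τ = ((χ₁, 1) ∘ proj) ⊗ δ^{1∕2}`;
the letters `R hR hwit` are ★ (B-2b″)'s `hR` and the conclusion of its `cells_witness_kZero`, VERBATIM.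
THE POINT.  Off its cell, a point `w₀u` (resp. `w₀uw₀`) is read through `w₀u = p·κ` (FILE A §1; `κ ∈ J_e` ⟺ the deep inequalities) resp. directly as `n̄ = w₀uw₀ ∈ N̄`: the lower unipotent
`κ` ∕ `n̄` is either on the SHARP big cell — then `= p′·w₀·u′`, `u′ ∈ J_e` (★ p862537 `exists_borel_mul_weylLongU_mul_mem_of_v_apply_div_le`) and the value carries the factor `f(w₀)` ∕ is
excluded — or in `J_e` (value carries `f(1)`), or in the shell family `R`, where `f = 0` (★ (B-0) `toFun_eq_zero_of_mem_cells`).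
* **`toFun_weyl_mul_eq_zero_of_not_mem`** (`f(1) = 0`, `u ∉ J_e`), **`toFun_weyl_mul_eq_zero_of_not_deep`** (`f(w₀) = 0`, `u` off the deep cell),
  **`toFun_conj_weyl_eq_zero_of_not_sharp`** (`f(1) = 0`, `u` off the sharp cell), **`toFun_conj_weyl_eq_zero_of_not_mem`** (`f(w₀) = 0`, `w₀uw₀ ∉ J_e`).
HONEST LABEL.  HC_CM is proved only modulo the 7 printed citations (2 remaining named inputs: hLiu418 = `stmt-HodgeConjecture-24832`, h413 = `stmt-HodgeConjecture-24833`) until rung 0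
closes; count-neutral — pointwise integrand values close NOTHING; :182 ∕ A2′ OPEN; REL ≠ ★ ≠ BUILT.

## References
* [Casselman1995] W. Casselman, *Introduction to the theory of admissible representations of `p`-adic reductive groups* (1995), Prop. 1.3.1, §6.3–§6.4.
* [Roche1998] A. Roche, *Types and Hecke algebras for principal series representations of split reductive p-adic groups*, Ann. Sci. ÉNS (4) 31 (1998), §3–§4.
* [Keys1984] D. Keys, *Principal series representations of special unitary groups over local fields*, Compositio Math. 51 (1984), §3, §7 Theorem (2) p. 126.
* [Rogawski1990] J. D. Rogawski, *Automorphic Representations of Unitary Groups in Three Variables*, Ann. of Math. Stud. 123 (1990), §1.10 p. 9, §12.1 p. 171.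
* [BruhatTits1972] F. Bruhat, J. Tits, *Groupes réductifs sur un corps local I*, Publ. Math. IHÉS 41 (1972), (4.4.4), (6.4.9).
-/

set_option autoImplicit false
-- the mandated namespace has the single-problem summit's repeated segment (`HodgeConjecture.HodgeConjecture`)
set_option linter.dupNamespace false

noncomputable section

open NumberField IsDedekindDomain
open scoped Matrix MatrixGroups WithZero Valued NNReal
open Literature.NumberTheory Literature.NumberTheory.Automorphic Literature.NumberTheory.Automorphic.UnitaryGroup
open Literature.NumberTheory.Rogawski1990

namespace Summit.HodgeConjecture.HodgeConjecture.R90.S1.BposPairIntegrandsTwoDepth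

open Summit.HodgeConjecture.HodgeConjecture.Cruxes.H413
open Summit.HodgeConjecture.HodgeConjecture.Cruxes.H413.K2E3DepthZeroIwahoriCharacterCM
open Summit.HodgeConjecture.HodgeConjecture.Cruxes.H413.K2E3BranchALettersCM
open Summit.HodgeConjecture.HodgeConjecture.Cruxes.H413.K2E3BranchBCellFunctionsCM
open Summit.HodgeConjecture.HodgeConjecture.R90.S1

variable (L : Type) [Field L] [NumberField L] [IsCMField L] (v : HeightOneSpectrum (𝓞 ↥(maximalRealSubfield L)))
  (w : PlacesOver L v) (hw : IsCMField.complexConj L • w.1 = w.1)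
  (eA : Gqs L v ≃ₜ* ↥(unitaryGroupOfForm (galAdicCompletionMap (L := L) (IsCMField.complexConj L) hw) ((StdForm.antidiagonal 3).over (w.1.adicCompletion L))))
  (heA : ∀ g : Gqs L v,
    ((eA g : ↥(unitaryGroupOfForm (galAdicCompletionMap (L := L) (IsCMField.complexConj L) hw) ((StdForm.antidiagonal 3).over (w.1.adicCompletion L)))) :
        GL (Fin 3) (w.1.adicCompletion L)) =
      ((localNonsplitEquiv (IsCMField.complexConj L) (qsForm L) (IsCMField.complexConj_ne_one L) w hw g :
        ↥(unitaryGroupOfForm (galAdicCompletionMap (L := L) (IsCMField.complexConj L) hw) (placeForm (qsForm L) w.1))) : GL (Fin 3) (w.1.adicCompletion L)))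
  {ϖ : w.1.adicCompletion L} (hϖ : Valued.v ϖ = WithZero.exp (-1 : ℤ))
  (r₁ r₂ : ℕ) (Jg : Subgroup ↥(unitaryGroupOfForm (galAdicCompletionMap (L := L) (IsCMField.complexConj L) hw) ((StdForm.antidiagonal 3).over (w.1.adicCompletion L))))
  (hJg : ∀ k : ↥(unitaryGroupOfForm (galAdicCompletionMap (L := L) (IsCMField.complexConj L) hw) ((StdForm.antidiagonal 3).over (w.1.adicCompletion L))),
    k ∈ Jg ↔ ∀ i j, Valued.v (((k : GL (Fin 3) (w.1.adicCompletion L)) : Matrix (Fin 3) (Fin 3) (w.1.adicCompletion L)) i j) ≤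
      Valued.v ϖ ^ (![![0, r₁, 0], ![r₂, 0, r₁], ![1, r₂, 0]] : Fin 3 → Fin 3 → ℕ) i j)
  (Je : Subgroup (Gqs L v)) (hJe : Je = Jg.comap eA.toMulEquiv.toMonoidHom)
  (w₀ : Gqs L v) (hw₀ : Units.val (w₀.val : GL (Fin 3) (LocalRing L v)) = cmLocalForm L 3 v)
  (χ₁ : (LocalRing L v)ˣ →* ℂˣ)

/-! ## The vanishing off the cells (letters `R hR hwit` of ★ (B-2b″)) -/


open Classical in
include hw heA hJg hJe hw₀ in
set_option maxHeartbeats 1600000 in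
set_option synthInstance.maxHeartbeats 400000 in
-- two carriers, slow unification (as above)
/-- **`f(w₀ u) = 0` for `u ∈ N(L⁺_v) ∖ J_e` when `f(1) = 0`** (the normalised `f_w`): `u ≠ 1`, so `z ≠ 0` and `w₀u = p·κ` (§1); if `κ ∈ J_e` the value is `τ(p)θ(κ)f(1) = 0`; else `κ`
is NOT on the sharp big cell (that would force `|x| ≤ |ϖ|^{r₁}`, `|z| ≤ 1`, i.e. `u ∈ J_e`, ★ p862537 `mem_of_coe_eq_upper`), so `κ ∈ R` (§1 `lower_mem_map_conj`) and `f` VANISHES on `P·κ·J_e`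
(★ (B-0) `toFun_eq_zero_of_mem_cells`, letter `hwit`).  With §2: `f_w(w₀u) = 𝟙[u ∈ J_e]` — memo (M12). [cite: Roche1998, §3–§4] [cite: Casselman1995, §6.3] [cite: Keys1984, §7 Theorem (2) p. 126] -/
theorem toFun_weyl_mul_eq_zero_of_not_mem
    (f : haveI := locallyCompactSpace_cmBorelU L 3 v
      Representation.SmoothInd (cmBorelTriple L 3 v).P
        (Representation.twist (((Representation.trivial ℂ ↥(torusU (conjLocal L (IsCMField.complexConj L) v) (cmLocalForm L 3 v)) ℂ).twist
          (cmTorusCharPair L v χ₁ 1)).comp (cmBorelTriple L 3 v).proj) (rootDeltaChar (cmBorelTriple L 3 v).P)))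
    (heig : ∀ x ∈ Je, (haveI := locallyCompactSpace_cmBorelU L 3 v; Representation.smoothIndRep _ _ x f) =
      (if h : IsUnit (((x.val : GL (Fin 3) (LocalRing L v)) : Matrix (Fin 3) (Fin 3) (LocalRing L v)) 0 0) then ((χ₁ h.unit : ℂˣ) : ℂ) else 0) • f)
    (R : Set ↥(unitaryGroupOfForm (conjLocal L (IsCMField.complexConj L) v) (cmLocalForm L 3 v)))
    (hR : ∀ r : ↥(unitaryGroupOfForm (conjLocal L (IsCMField.complexConj L) v) (cmLocalForm L 3 v)), r ∈ R ↔
    r ∈ ((cmBorelTriple L 3 v).N).map (MulAut.conj w₀).toMonoidHom ∧ r ∉ Je ∧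
      ¬ (Valued.v ((((eA r : ↥(unitaryGroupOfForm (galAdicCompletionMap (L := L) (IsCMField.complexConj L) hw) ((StdForm.antidiagonal 3).over (w.1.adicCompletion L)))) : GL (Fin 3) (w.1.adicCompletion L)) : Matrix (Fin 3) (Fin 3) (w.1.adicCompletion L)) 2 1 /
            (((eA r : ↥(unitaryGroupOfForm (galAdicCompletionMap (L := L) (IsCMField.complexConj L) hw) ((StdForm.antidiagonal 3).over (w.1.adicCompletion L)))) : GL (Fin 3) (w.1.adicCompletion L)) : Matrix (Fin 3) (Fin 3) (w.1.adicCompletion L)) 2 0) ≤ Valued.v ϖ ^ r₁ ∧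
          (Valued.v ϖ ^ 0)⁻¹ ≤ Valued.v ((((eA r : ↥(unitaryGroupOfForm (galAdicCompletionMap (L := L) (IsCMField.complexConj L) hw) ((StdForm.antidiagonal 3).over (w.1.adicCompletion L)))) : GL (Fin 3) (w.1.adicCompletion L)) : Matrix (Fin 3) (Fin 3) (w.1.adicCompletion L)) 2 0)))
    (hwit : ∀ r ∈ R, ∃ b₀ : ↥(unitaryGroupOfForm (conjLocal L (IsCMField.complexConj L) v) (cmLocalForm L 3 v)), b₀ ∈ Je ∧ ∃ hb₀P : r * b₀ * r⁻¹ ∈ (cmBorelTriple L 3 v).P,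
      (if h : IsUnit (((b₀ : GL (Fin 3) (LocalRing L v)) : Matrix (Fin 3) (Fin 3) (LocalRing L v)) 0 0) then ((χ₁ h.unit : ℂˣ) : ℂ) else 0) ≠
        (haveI := locallyCompactSpace_cmBorelU L 3 v
         (Representation.twist
            (((Representation.trivial ℂ ↥(torusU (conjLocal L (IsCMField.complexConj L) v) (cmLocalForm L 3 v)) ℂ).twist
              (cmTorusCharPair L v χ₁ 1)).comp (cmBorelTriple L 3 v).proj) (rootDeltaChar (cmBorelTriple L 3 v).P))
          ⟨r * b₀ * r⁻¹, hb₀P⟩ 1))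
    (hw1 : f.toFun 1 = 0)
    {u : Gqs L v} (hu : (u : ↥(unitaryGroupOfForm (conjLocal L (IsCMField.complexConj L) v) (cmLocalForm L 3 v))) ∈ (cmBorelTriple L 3 v).N) (huJ : u ∉ Je) :
    f.toFun (w₀ * u) = 0 := by
  haveI := locallyCompactSpace_cmBorelU L 3 v
  have hvσ : ∀ y, Valued.v (galAdicCompletionMap (L := L) (IsCMField.complexConj L) hw y) = Valued.v y :=
    fun y => valued_galAdicCompletionMap (L := L) (IsCMField.complexConj L) hw y
  obtain ⟨x, z, hux, hrel⟩ := exists_coe_eA_eq_upper L v w hw eA heA (cmBorelTriple L 3 v) rfl hu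
  -- `z ≠ 0` (else `u = 1 ∈ J_e`)
  have hz0 : z ≠ 0 := fun hz => huJ (by
    have h1 : eA u = 1 := BposBruhatCellsTwoDepth.one_of_coe_eq_upper_of_eq_zero _ hux hrel hz
    rw [show u = 1 from eA.injective (by rw [h1, map_one])]
    exact Je.one_mem)
  obtain ⟨p, hp, κ, hfac, hpm, hκm⟩ := exists_eq_mul_of_ne_zero L v w hw eA heA w₀ hw₀ hux hrel hz0
  by_cases hκJ : κ ∈ Je
  · -- the closed cell `P·J_e`: value `τ(p)θ(κ)f(1) = 0`
    have hcell := toFun_weyl_mul_of_eq_mul L v Je (cmBorelTriple L 3 v) w₀ _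
      (fun g : Gqs L v => if h : IsUnit (((g.val : GL (Fin 3) (LocalRing L v)) : Matrix (Fin 3) (Fin 3) (LocalRing L v)) 0 0) then ((χ₁ h.unit : ℂˣ) : ℂ) else 0) f heig hp hκJ hfac
    exact hcell.trans (mul_eq_zero_of_right _ hw1)
  · -- `κ` is off the sharp cell (else `u ∈ J_e`), hence in `R`
    have h20 : (((eA κ : ↥(unitaryGroupOfForm (galAdicCompletionMap (L := L) (IsCMField.complexConj L) hw) ((StdForm.antidiagonal 3).over (w.1.adicCompletion L)))) :
        GL (Fin 3) (w.1.adicCompletion L)) : Matrix (Fin 3) (Fin 3) (w.1.adicCompletion L)) 2 0 = z⁻¹ := by rw [hκm]; rfl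
    have h21 : (((eA κ : ↥(unitaryGroupOfForm (galAdicCompletionMap (L := L) (IsCMField.complexConj L) hw) ((StdForm.antidiagonal 3).over (w.1.adicCompletion L)))) :
        GL (Fin 3) (w.1.adicCompletion L)) : Matrix (Fin 3) (Fin 3) (w.1.adicCompletion L)) 2 1 = x * z⁻¹ := by rw [hκm]; rfl
    have hns : ¬ (Valued.v ((((eA κ : ↥(unitaryGroupOfForm (galAdicCompletionMap (L := L) (IsCMField.complexConj L) hw) ((StdForm.antidiagonal 3).over (w.1.adicCompletion L)))) : GL (Fin 3) (w.1.adicCompletion L)) : Matrix (Fin 3) (Fin 3) (w.1.adicCompletion L)) 2 1 /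
            (((eA κ : ↥(unitaryGroupOfForm (galAdicCompletionMap (L := L) (IsCMField.complexConj L) hw) ((StdForm.antidiagonal 3).over (w.1.adicCompletion L)))) : GL (Fin 3) (w.1.adicCompletion L)) : Matrix (Fin 3) (Fin 3) (w.1.adicCompletion L)) 2 0) ≤ Valued.v ϖ ^ r₁ ∧
          (Valued.v ϖ ^ 0)⁻¹ ≤ Valued.v ((((eA κ : ↥(unitaryGroupOfForm (galAdicCompletionMap (L := L) (IsCMField.complexConj L) hw) ((StdForm.antidiagonal 3).over (w.1.adicCompletion L)))) : GL (Fin 3) (w.1.adicCompletion L)) : Matrix (Fin 3) (Fin 3) (w.1.adicCompletion L)) 2 0)) := by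
      rintro ⟨hx, hz⟩
      rw [h20, h21, mul_div_assoc, div_self (inv_ne_zero hz0), mul_one] at hx
      rw [h20, pow_zero, inv_one, map_inv₀, one_le_inv₀ (zero_lt_iff.2 ((Valuation.ne_zero_iff _).2 hz0))] at hz
      refine huJ ?_
      rw [hJe, Subgroup.mem_comap]
      exact K2E3LowerUnipotentDeepCellTwoDepth.mem_of_coe_eq_upper (galAdicCompletionMap (L := L) (IsCMField.complexConj L) hw) hvσ _ Jg hJg
        (fun i => by fin_cases i <;> rfl) (fun i j => by fin_cases i <;> fin_cases j <;> rfl) hux hx (by simpa using hz)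
    have hκR : (κ : ↥(unitaryGroupOfForm (conjLocal L (IsCMField.complexConj L) v) (cmLocalForm L 3 v))) ∈ R :=
      (hR κ).2 ⟨lower_mem_map_conj L v w hw eA heA w₀ hw₀ hκm, hκJ, hns⟩
    exact BranchBDeterminantVanishingCells.toFun_eq_zero_of_mem_cells (cmBorelTriple L 3 v).P _ Je
      (fun g : ↥(unitaryGroupOfForm (conjLocal L (IsCMField.complexConj L) v) (cmLocalForm L 3 v)) =>
        if h : IsUnit (((g : GL (Fin 3) (LocalRing L v)) : Matrix (Fin 3) (Fin 3) (LocalRing L v)) 0 0) then ((χ₁ h.unit : ℂˣ) : ℂ) else 0)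
      R hwit f heig (w₀ * u) ⟨κ, hκR, p, hp, 1, Je.one_mem, by rw [mul_one]; exact hfac⟩

open Classical in
include hw heA hϖ hJg hJe hw₀ in
set_option maxHeartbeats 1600000 in
set_option synthInstance.maxHeartbeats 400000 in
-- two carriers, slow unification (as above)
/-- **`f(w₀ u) = 0` OFF THE DEEP CELL when `f(w₀) = 0`** (the normalised `f₁`): if `z = 0` then `u = 1` and `f(w₀u) = f(w₀) = 0`; else `w₀u = p·κ` (§1) and `κ ∉ J_e` (membership would give
exactly the deep inequalities `|1∕z| ≤ |ϖ|`, `|x∕z| ≤ |ϖ|^{r₂}`); if `κ` is on the sharp big cell then `κ = p′·w₀·u′`, `u′ ∈ J_e` (★ p862537) and `f(w₀u) = τ(pp′)θ(u′)f(w₀) = 0` (★ Z2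
`toFun_mul_mul_eq_of_eigen`), else `κ ∈ R` and `f` vanishes on `P·κ·J_e` (★ (B-0)).  With §3: `f₁(w₀u) = 𝟙[deep]·χ₁((σb)⁻¹)‖b‖⁻¹` — memo (M11). [cite: Roche1998, §3–§4] [cite: Casselman1995, Prop. 1.3.1, §6.3]
[cite: Keys1984, §7 Theorem (2) p. 126] -/
theorem toFun_weyl_mul_eq_zero_of_not_deep
    (f : haveI := locallyCompactSpace_cmBorelU L 3 v
      Representation.SmoothInd (cmBorelTriple L 3 v).P
        (Representation.twist (((Representation.trivial ℂ ↥(torusU (conjLocal L (IsCMField.complexConj L) v) (cmLocalForm L 3 v)) ℂ).twist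
          (cmTorusCharPair L v χ₁ 1)).comp (cmBorelTriple L 3 v).proj) (rootDeltaChar (cmBorelTriple L 3 v).P)))
    (heig : ∀ x ∈ Je, (haveI := locallyCompactSpace_cmBorelU L 3 v; Representation.smoothIndRep _ _ x f) =
      (if h : IsUnit (((x.val : GL (Fin 3) (LocalRing L v)) : Matrix (Fin 3) (Fin 3) (LocalRing L v)) 0 0) then ((χ₁ h.unit : ℂˣ) : ℂ) else 0) • f)
    (R : Set ↥(unitaryGroupOfForm (conjLocal L (IsCMField.complexConj L) v) (cmLocalForm L 3 v)))
    (hR : ∀ r : ↥(unitaryGroupOfForm (conjLocal L (IsCMField.complexConj L) v) (cmLocalForm L 3 v)), r ∈ R ↔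
    r ∈ ((cmBorelTriple L 3 v).N).map (MulAut.conj w₀).toMonoidHom ∧ r ∉ Je ∧
      ¬ (Valued.v ((((eA r : ↥(unitaryGroupOfForm (galAdicCompletionMap (L := L) (IsCMField.complexConj L) hw) ((StdForm.antidiagonal 3).over (w.1.adicCompletion L)))) : GL (Fin 3) (w.1.adicCompletion L)) : Matrix (Fin 3) (Fin 3) (w.1.adicCompletion L)) 2 1 /
            (((eA r : ↥(unitaryGroupOfForm (galAdicCompletionMap (L := L) (IsCMField.complexConj L) hw) ((StdForm.antidiagonal 3).over (w.1.adicCompletion L)))) : GL (Fin 3) (w.1.adicCompletion L)) : Matrix (Fin 3) (Fin 3) (w.1.adicCompletion L)) 2 0) ≤ Valued.v ϖ ^ r₁ ∧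
          (Valued.v ϖ ^ 0)⁻¹ ≤ Valued.v ((((eA r : ↥(unitaryGroupOfForm (galAdicCompletionMap (L := L) (IsCMField.complexConj L) hw) ((StdForm.antidiagonal 3).over (w.1.adicCompletion L)))) : GL (Fin 3) (w.1.adicCompletion L)) : Matrix (Fin 3) (Fin 3) (w.1.adicCompletion L)) 2 0)))
    (hwit : ∀ r ∈ R, ∃ b₀ : ↥(unitaryGroupOfForm (conjLocal L (IsCMField.complexConj L) v) (cmLocalForm L 3 v)), b₀ ∈ Je ∧ ∃ hb₀P : r * b₀ * r⁻¹ ∈ (cmBorelTriple L 3 v).P,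
      (if h : IsUnit (((b₀ : GL (Fin 3) (LocalRing L v)) : Matrix (Fin 3) (Fin 3) (LocalRing L v)) 0 0) then ((χ₁ h.unit : ℂˣ) : ℂ) else 0) ≠
        (haveI := locallyCompactSpace_cmBorelU L 3 v
         (Representation.twist
            (((Representation.trivial ℂ ↥(torusU (conjLocal L (IsCMField.complexConj L) v) (cmLocalForm L 3 v)) ℂ).twist
              (cmTorusCharPair L v χ₁ 1)).comp (cmBorelTriple L 3 v).proj) (rootDeltaChar (cmBorelTriple L 3 v).P))
          ⟨r * b₀ * r⁻¹, hb₀P⟩ 1))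
    (h1g : f.toFun w₀ = 0)
    {u : Gqs L v} (hu : (u : ↥(unitaryGroupOfForm (conjLocal L (IsCMField.complexConj L) v) (cmLocalForm L 3 v))) ∈ (cmBorelTriple L 3 v).N)
    (hnd : ¬ ((Valued.v ϖ ^ 1)⁻¹ ≤ Valued.v ((((u.val : GL (Fin 3) (LocalRing L v)) : Matrix (Fin 3) (Fin 3) (LocalRing L v)) 0 2) w) ∧ Valued.v ((((u.val : GL (Fin 3) (LocalRing L v)) : Matrix (Fin 3) (Fin 3) (LocalRing L v)) 0 1) w / (((u.val : GL (Fin 3) (LocalRing L v)) : Matrix (Fin 3) (Fin 3) (LocalRing L v)) 0 2) w) ≤ Valued.v ϖ ^ r₂)) :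
    f.toFun (w₀ * u) = 0 := by
  haveI := locallyCompactSpace_cmBorelU L 3 v
  have hσσ : ∀ y, (galAdicCompletionMap (L := L) (IsCMField.complexConj L) hw) ((galAdicCompletionMap (L := L) (IsCMField.complexConj L) hw) y) = y :=
    galAdicCompletionMap_galAdicCompletionMap_of_smul_eq (IsCMField.complexConj L) w (IsCMField.complexConj_ne_one L) hw
  have hvσ : ∀ y, Valued.v (galAdicCompletionMap (L := L) (IsCMField.complexConj L) hw y) = Valued.v y :=
    fun y => valued_galAdicCompletionMap (L := L) (IsCMField.complexConj L) hw y
  have hvϖ0 : Valued.v ϖ ≠ 0 := (Valuation.ne_zero_iff _).2 (CartanUnique.uniformizer_ne_zero hϖ)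
  obtain ⟨x, z, hux, hrel⟩ := exists_coe_eA_eq_upper L v w hw eA heA (cmBorelTriple L 3 v) rfl hu
  have hz02 : (((u.val : GL (Fin 3) (LocalRing L v)) : Matrix (Fin 3) (Fin 3) (LocalRing L v)) 0 2) w = z := by
    rw [← coe_eA_apply L v w hw eA heA u 0 2, hux]; rfl
  have hx01 : (((u.val : GL (Fin 3) (LocalRing L v)) : Matrix (Fin 3) (Fin 3) (LocalRing L v)) 0 1) w = x := by
    rw [← coe_eA_apply L v w hw eA heA u 0 1, hux]; rfl
  rw [hz02, hx01] at hnd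
  by_cases hz0 : z = 0
  · -- `u = 1`: `f(w₀ · 1) = f(w₀) = 0`
    have h1 : eA u = 1 := BposBruhatCellsTwoDepth.one_of_coe_eq_upper_of_eq_zero _ hux hrel hz0
    have hu1 : u = 1 := eA.injective (by rw [h1, map_one])
    rw [hu1, mul_one]
    exact h1g
  obtain ⟨p, hp, κ, hfac, hpm, hκm⟩ := exists_eq_mul_of_ne_zero L v w hw eA heA w₀ hw₀ hux hrel hz0
  have h20 : (((eA κ : ↥(unitaryGroupOfForm (galAdicCompletionMap (L := L) (IsCMField.complexConj L) hw) ((StdForm.antidiagonal 3).over (w.1.adicCompletion L)))) : GL (Fin 3) (w.1.adicCompletion L)) : Matrix (Fin 3) (Fin 3) (w.1.adicCompletion L)) 2 0 = z⁻¹ := by rw [hκm]; rfl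
  have h21 : (((eA κ : ↥(unitaryGroupOfForm (galAdicCompletionMap (L := L) (IsCMField.complexConj L) hw) ((StdForm.antidiagonal 3).over (w.1.adicCompletion L)))) : GL (Fin 3) (w.1.adicCompletion L)) : Matrix (Fin 3) (Fin 3) (w.1.adicCompletion L)) 2 1 = x * z⁻¹ := by rw [hκm]; rfl
  by_cases hκJ : κ ∈ Je
  · -- `κ ∈ J_e` would put `u` on the deep cell
    exfalso
    have hk := (hJg (eA κ)).1 (by rw [hJe, Subgroup.mem_comap] at hκJ; exact hκJ)
    have h20v : (Valued.v z)⁻¹ ≤ Valued.v ϖ := by simpa [h20] using hk 2 0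
    have h21v : Valued.v x * (Valued.v z)⁻¹ ≤ Valued.v ϖ ^ r₂ := by simpa [h21] using hk 2 1
    refine hnd ⟨?_, ?_⟩
    · rw [pow_one]
      exact (inv_le_comm₀ (zero_lt_iff.2 ((Valuation.ne_zero_iff _).2 hz0)) (zero_lt_iff.2 hvϖ0)).1 h20v
    · rw [map_div₀, div_eq_mul_inv]; exact h21v
  by_cases hsharp : Valued.v ((((eA κ : ↥(unitaryGroupOfForm (galAdicCompletionMap (L := L) (IsCMField.complexConj L) hw) ((StdForm.antidiagonal 3).over (w.1.adicCompletion L)))) : GL (Fin 3) (w.1.adicCompletion L)) : Matrix (Fin 3) (Fin 3) (w.1.adicCompletion L)) 2 1 / (((eA κ : ↥(unitaryGroupOfForm (galAdicCompletionMap (L := L) (IsCMField.complexConj L) hw) ((StdForm.antidiagonal 3).over (w.1.adicCompletion L)))) : GL (Fin 3) (w.1.adicCompletion L)) : Matrix (Fin 3) (Fin 3) (w.1.adicCompletion L)) 2 0) ≤ Valued.v ϖ ^ r₁ ∧ (Valued.v ϖ ^ 0)⁻¹ ≤ Valued.v ((((eA κ : ↥(unitaryGroupOfForm (galAdicCompletionMap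 (L := L) (IsCMField.complexConj L) hw) ((StdForm.antidiagonal 3).over (w.1.adicCompletion L)))) : GL (Fin 3) (w.1.adicCompletion L)) : Matrix (Fin 3) (Fin 3) (w.1.adicCompletion L)) 2 0)
  · -- `κ` on the sharp big cell: `κ = p′·w₀·u′`, `u′ ∈ J_e`, value `τ(pp′)θ(u′)f(w₀) = 0`
    obtain ⟨p', hp', u', hu', heq⟩ := K2E3LowerUnipotentDeepCellTwoDepth.exists_borel_mul_weylLongU_mul_mem_of_v_apply_div_le
      (galAdicCompletionMap (L := L) (IsCMField.complexConj L) hw) (rfl : (StdForm.antidiagonal 3).over (w.1.adicCompletion L) = _) hσσ hvσ hϖ _ Jg hJg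
      (fun i => by fin_cases i <;> rfl) (fun i j => by fin_cases i <;> fin_cases j <;> rfl) (lower_mem_map_conj_model L v w hw eA hκm) hsharp.1 hsharp.2
    have hκeq : κ = eA.symm p' * w₀ * eA.symm u' := eA.injective (by
      rw [heq, map_mul, map_mul, ContinuousMulEquiv.apply_symm_apply, ContinuousMulEquiv.apply_symm_apply, map_weyl_eq_weylLongU L v w hw eA heA w₀ hw₀])
    have hp'P := symm_mem_P_of_mem_borelU L v w hw eA heA (cmBorelTriple L 3 v) rfl hp'
    have hu'J : eA.symm u' ∈ Je := by
      rw [hJe, Subgroup.mem_comap]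
      change eA (eA.symm u') ∈ Jg
      rw [ContinuousMulEquiv.apply_symm_apply]
      exact hu'
    have hcell := K2E3IwahoriPlaneTwoCells.toFun_mul_mul_eq_of_eigen (cmBorelTriple L 3 v).P _ Je
      (fun g : ↥(unitaryGroupOfForm (conjLocal L (IsCMField.complexConj L) v) (cmLocalForm L 3 v)) =>
        if h : IsUnit (((g : GL (Fin 3) (LocalRing L v)) : Matrix (Fin 3) (Fin 3) (LocalRing L v)) 0 0) then ((χ₁ h.unit : ℂˣ) : ℂ) else 0)
      f heig (p * eA.symm p') ((cmBorelTriple L 3 v).P.mul_mem hp hp'P) w₀ (eA.symm u') hu'J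
    have hprod : w₀ * u = p * eA.symm p' * w₀ * eA.symm u' := by rw [hfac, hκeq]; simp only [mul_assoc]
    rw [hprod]
    exact hcell.trans (mul_eq_zero_of_right _ h1g)
  · -- `κ ∈ R`: `f` vanishes on `P·κ·J_e`
    have hκR : (κ : ↥(unitaryGroupOfForm (conjLocal L (IsCMField.complexConj L) v) (cmLocalForm L 3 v))) ∈ R :=
      (hR κ).2 ⟨lower_mem_map_conj L v w hw eA heA w₀ hw₀ hκm, hκJ, hsharp⟩
    exact BranchBDeterminantVanishingCells.toFun_eq_zero_of_mem_cells (cmBorelTriple L 3 v).P _ Je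
      (fun g : ↥(unitaryGroupOfForm (conjLocal L (IsCMField.complexConj L) v) (cmLocalForm L 3 v)) =>
        if h : IsUnit (((g : GL (Fin 3) (LocalRing L v)) : Matrix (Fin 3) (Fin 3) (LocalRing L v)) 0 0) then ((χ₁ h.unit : ℂˣ) : ℂ) else 0)
      R hwit f heig (w₀ * u) ⟨κ, hκR, p, hp, 1, Je.one_mem, by rw [mul_one]; exact hfac⟩

open Classical in
include hw heA hw₀ in
set_option maxHeartbeats 1600000 in
set_option synthInstance.maxHeartbeats 400000 in
-- two carriers, slow unification (as above)
/-- **`f(w₀ u w₀) = 0` OFF THE SHARP CELL when `f(1) = 0`** (the normalised `f_w`): if `w₀uw₀ ∈ J_e` the value is `θ·f(1) = 0` (§2); else `w₀uw₀ ∈ R` (off `J_e`, off the sharp cell: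
`eA(w₀uw₀) = ū(x, z)` ★ `coe_eA_conj_eq_lower`) and `f` vanishes there (★ (B-0)).  With §3: `f_w(w₀uw₀) = 𝟙[sharp]·χ₁((σb)⁻¹)‖b‖⁻¹` — memo (M22). [cite: Roche1998, §3–§4] [cite: Casselman1995, §6.3]
[cite: Keys1984, §7 Theorem (2) p. 126] -/
theorem toFun_conj_weyl_eq_zero_of_not_sharp
    (f : haveI := locallyCompactSpace_cmBorelU L 3 v
      Representation.SmoothInd (cmBorelTriple L 3 v).P
        (Representation.twist (((Representation.trivial ℂ ↥(torusU (conjLocal L (IsCMField.complexConj L) v) (cmLocalForm L 3 v)) ℂ).twist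
          (cmTorusCharPair L v χ₁ 1)).comp (cmBorelTriple L 3 v).proj) (rootDeltaChar (cmBorelTriple L 3 v).P)))
    (heig : ∀ x ∈ Je, (haveI := locallyCompactSpace_cmBorelU L 3 v; Representation.smoothIndRep _ _ x f) =
      (if h : IsUnit (((x.val : GL (Fin 3) (LocalRing L v)) : Matrix (Fin 3) (Fin 3) (LocalRing L v)) 0 0) then ((χ₁ h.unit : ℂˣ) : ℂ) else 0) • f)
    (R : Set ↥(unitaryGroupOfForm (conjLocal L (IsCMField.complexConj L) v) (cmLocalForm L 3 v)))
    (hR : ∀ r : ↥(unitaryGroupOfForm (conjLocal L (IsCMField.complexConj L) v) (cmLocalForm L 3 v)), r ∈ R ↔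
    r ∈ ((cmBorelTriple L 3 v).N).map (MulAut.conj w₀).toMonoidHom ∧ r ∉ Je ∧
      ¬ (Valued.v ((((eA r : ↥(unitaryGroupOfForm (galAdicCompletionMap (L := L) (IsCMField.complexConj L) hw) ((StdForm.antidiagonal 3).over (w.1.adicCompletion L)))) : GL (Fin 3) (w.1.adicCompletion L)) : Matrix (Fin 3) (Fin 3) (w.1.adicCompletion L)) 2 1 /
            (((eA r : ↥(unitaryGroupOfForm (galAdicCompletionMap (L := L) (IsCMField.complexConj L) hw) ((StdForm.antidiagonal 3).over (w.1.adicCompletion L)))) : GL (Fin 3) (w.1.adicCompletion L)) : Matrix (Fin 3) (Fin 3) (w.1.adicCompletion L)) 2 0) ≤ Valued.v ϖ ^ r₁ ∧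
          (Valued.v ϖ ^ 0)⁻¹ ≤ Valued.v ((((eA r : ↥(unitaryGroupOfForm (galAdicCompletionMap (L := L) (IsCMField.complexConj L) hw) ((StdForm.antidiagonal 3).over (w.1.adicCompletion L)))) : GL (Fin 3) (w.1.adicCompletion L)) : Matrix (Fin 3) (Fin 3) (w.1.adicCompletion L)) 2 0)))
    (hwit : ∀ r ∈ R, ∃ b₀ : ↥(unitaryGroupOfForm (conjLocal L (IsCMField.complexConj L) v) (cmLocalForm L 3 v)), b₀ ∈ Je ∧ ∃ hb₀P : r * b₀ * r⁻¹ ∈ (cmBorelTriple L 3 v).P,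
      (if h : IsUnit (((b₀ : GL (Fin 3) (LocalRing L v)) : Matrix (Fin 3) (Fin 3) (LocalRing L v)) 0 0) then ((χ₁ h.unit : ℂˣ) : ℂ) else 0) ≠
        (haveI := locallyCompactSpace_cmBorelU L 3 v
         (Representation.twist
            (((Representation.trivial ℂ ↥(torusU (conjLocal L (IsCMField.complexConj L) v) (cmLocalForm L 3 v)) ℂ).twist
              (cmTorusCharPair L v χ₁ 1)).comp (cmBorelTriple L 3 v).proj) (rootDeltaChar (cmBorelTriple L 3 v).P))
          ⟨r * b₀ * r⁻¹, hb₀P⟩ 1))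
    (hw1 : f.toFun 1 = 0)
    {u : Gqs L v} (hu : (u : ↥(unitaryGroupOfForm (conjLocal L (IsCMField.complexConj L) v) (cmLocalForm L 3 v))) ∈ (cmBorelTriple L 3 v).N)
    (hns : ¬ (Valued.v ((((u.val : GL (Fin 3) (LocalRing L v)) : Matrix (Fin 3) (Fin 3) (LocalRing L v)) 0 1) w / (((u.val : GL (Fin 3) (LocalRing L v)) : Matrix (Fin 3) (Fin 3) (LocalRing L v)) 0 2) w) ≤ Valued.v ϖ ^ r₁ ∧ (Valued.v ϖ ^ 0)⁻¹ ≤ Valued.v ((((u.val : GL (Fin 3) (LocalRing L v)) : Matrix (Fin 3) (Fin 3) (LocalRing L v)) 0 2) w))) :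
    f.toFun (w₀ * u * w₀) = 0 := by
  haveI := locallyCompactSpace_cmBorelU L 3 v
  by_cases hJ : w₀ * u * w₀ ∈ Je
  · exact (toFun_conj_weyl_eq_of_mem L v w hw eA heA Je w₀ hw₀ χ₁ f heig hu hJ).trans hw1
  obtain ⟨x, z, hux, -⟩ := exists_coe_eA_eq_upper L v w hw eA heA (cmBorelTriple L 3 v) rfl hu
  have hz02 : (((u.val : GL (Fin 3) (LocalRing L v)) : Matrix (Fin 3) (Fin 3) (LocalRing L v)) 0 2) w = z := by
    rw [← coe_eA_apply L v w hw eA heA u 0 2, hux]; rfl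
  have hx01 : (((u.val : GL (Fin 3) (LocalRing L v)) : Matrix (Fin 3) (Fin 3) (LocalRing L v)) 0 1) w = x := by
    rw [← coe_eA_apply L v w hw eA heA u 0 1, hux]; rfl
  have hlow := coe_eA_conj_eq_lower L v w hw eA heA w₀ hw₀ hux
  have h20 : (((eA (w₀ * u * w₀) : ↥(unitaryGroupOfForm (galAdicCompletionMap (L := L) (IsCMField.complexConj L) hw) ((StdForm.antidiagonal 3).over (w.1.adicCompletion L)))) : GL (Fin 3) (w.1.adicCompletion L)) : Matrix (Fin 3) (Fin 3) (w.1.adicCompletion L)) 2 0 = z := by rw [hlow]; rfl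
  have h21 : (((eA (w₀ * u * w₀) : ↥(unitaryGroupOfForm (galAdicCompletionMap (L := L) (IsCMField.complexConj L) hw) ((StdForm.antidiagonal 3).over (w.1.adicCompletion L)))) : GL (Fin 3) (w.1.adicCompletion L)) : Matrix (Fin 3) (Fin 3) (w.1.adicCompletion L)) 2 1 = x := by rw [hlow]; rfl
  have hns' : ¬ (Valued.v ((((eA (w₀ * u * w₀) : ↥(unitaryGroupOfForm (galAdicCompletionMap (L := L) (IsCMField.complexConj L) hw) ((StdForm.antidiagonal 3).over (w.1.adicCompletion L)))) : GL (Fin 3) (w.1.adicCompletion L)) : Matrix (Fin 3) (Fin 3) (w.1.adicCompletion L)) 2 1 / (((eA (w₀ * u * w₀) : ↥(unitaryGroupOfForm (galAdicCompletionMap (L := L) (IsCMField.complexConj L) hw) ((StdForm.antidiagonal 3).over (w.1.adicCompletion L)))) : GL (Fin 3) (w.1.adicCompletion L)) : Matrix (Fin 3) (Fin 3) (w.1.adicCompletion L)) 2 0) ≤ Valued.v ϖ ^ r₁ ∧ (Valued.v ϖ ^ 0)⁻¹ ≤ Valued.v ((((eA (w₀ * u * w₀) : ↥(unitaryGroupOfForm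 (galAdicCompletionMap (L := L) (IsCMField.complexConj L) hw) ((StdForm.antidiagonal 3).over (w.1.adicCompletion L)))) : GL (Fin 3) (w.1.adicCompletion L)) : Matrix (Fin 3) (Fin 3) (w.1.adicCompletion L)) 2 0)) := by
    rw [h20, h21]; rw [hz02, hx01] at hns; exact hns
  have hrR : ((w₀ * u * w₀ : Gqs L v) : ↥(unitaryGroupOfForm (conjLocal L (IsCMField.complexConj L) v) (cmLocalForm L 3 v))) ∈ R :=
    (hR _).2 ⟨conj_mem_map_conj L v w hw eA heA w₀ hw₀ hu, hJ, hns'⟩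
  exact BranchBDeterminantVanishingCells.toFun_eq_zero_of_mem_cells (cmBorelTriple L 3 v).P _ Je
    (fun g : ↥(unitaryGroupOfForm (conjLocal L (IsCMField.complexConj L) v) (cmLocalForm L 3 v)) =>
        if h : IsUnit (((g : GL (Fin 3) (LocalRing L v)) : Matrix (Fin 3) (Fin 3) (LocalRing L v)) 0 0) then ((χ₁ h.unit : ℂˣ) : ℂ) else 0)
    R hwit f heig (w₀ * u * w₀) ⟨_, hrR, 1, ((cmBorelTriple L 3 v).P).one_mem, 1, Je.one_mem, by rw [one_mul, mul_one]⟩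

open Classical in
include hw heA hϖ hJg hJe hw₀ in
set_option maxHeartbeats 1600000 in
set_option synthInstance.maxHeartbeats 400000 in
-- two carriers, slow unification (as above)
/-- **`f(w₀ u w₀) = 0` OFF `J_e` when `f(w₀) = 0`** (the normalised `f₁`): if `w₀uw₀` is on the sharp big cell then `w₀uw₀ = p′·w₀·u′`, `u′ ∈ J_e` (★ p862537) and the value is
`τ(p′)θ(u′)f(w₀) = 0` (★ Z2 `toFun_mul_mul_eq_of_eigen`); else `w₀uw₀ ∈ R` and `f` vanishes there (★ (B-0)).  With §2: `f₁(w₀uw₀) = 𝟙[w₀uw₀ ∈ J_e]` — memo (M21). [cite: Roche1998, §3–§4]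
[cite: Casselman1995, Prop. 1.3.1, §6.3] [cite: Keys1984, §7 Theorem (2) p. 126] -/
theorem toFun_conj_weyl_eq_zero_of_not_mem
    (f : haveI := locallyCompactSpace_cmBorelU L 3 v
      Representation.SmoothInd (cmBorelTriple L 3 v).P
        (Representation.twist (((Representation.trivial ℂ ↥(torusU (conjLocal L (IsCMField.complexConj L) v) (cmLocalForm L 3 v)) ℂ).twist
          (cmTorusCharPair L v χ₁ 1)).comp (cmBorelTriple L 3 v).proj) (rootDeltaChar (cmBorelTriple L 3 v).P)))
    (heig : ∀ x ∈ Je, (haveI := locallyCompactSpace_cmBorelU L 3 v; Representation.smoothIndRep _ _ x f) =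
      (if h : IsUnit (((x.val : GL (Fin 3) (LocalRing L v)) : Matrix (Fin 3) (Fin 3) (LocalRing L v)) 0 0) then ((χ₁ h.unit : ℂˣ) : ℂ) else 0) • f)
    (R : Set ↥(unitaryGroupOfForm (conjLocal L (IsCMField.complexConj L) v) (cmLocalForm L 3 v)))
    (hR : ∀ r : ↥(unitaryGroupOfForm (conjLocal L (IsCMField.complexConj L) v) (cmLocalForm L 3 v)), r ∈ R ↔
    r ∈ ((cmBorelTriple L 3 v).N).map (MulAut.conj w₀).toMonoidHom ∧ r ∉ Je ∧
      ¬ (Valued.v ((((eA r : ↥(unitaryGroupOfForm (galAdicCompletionMap (L := L) (IsCMField.complexConj L) hw) ((StdForm.antidiagonal 3).over (w.1.adicCompletion L)))) : GL (Fin 3) (w.1.adicCompletion L)) : Matrix (Fin 3) (Fin 3) (w.1.adicCompletion L)) 2 1 /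
            (((eA r : ↥(unitaryGroupOfForm (galAdicCompletionMap (L := L) (IsCMField.complexConj L) hw) ((StdForm.antidiagonal 3).over (w.1.adicCompletion L)))) : GL (Fin 3) (w.1.adicCompletion L)) : Matrix (Fin 3) (Fin 3) (w.1.adicCompletion L)) 2 0) ≤ Valued.v ϖ ^ r₁ ∧
          (Valued.v ϖ ^ 0)⁻¹ ≤ Valued.v ((((eA r : ↥(unitaryGroupOfForm (galAdicCompletionMap (L := L) (IsCMField.complexConj L) hw) ((StdForm.antidiagonal 3).over (w.1.adicCompletion L)))) : GL (Fin 3) (w.1.adicCompletion L)) : Matrix (Fin 3) (Fin 3) (w.1.adicCompletion L)) 2 0)))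
    (hwit : ∀ r ∈ R, ∃ b₀ : ↥(unitaryGroupOfForm (conjLocal L (IsCMField.complexConj L) v) (cmLocalForm L 3 v)), b₀ ∈ Je ∧ ∃ hb₀P : r * b₀ * r⁻¹ ∈ (cmBorelTriple L 3 v).P,
      (if h : IsUnit (((b₀ : GL (Fin 3) (LocalRing L v)) : Matrix (Fin 3) (Fin 3) (LocalRing L v)) 0 0) then ((χ₁ h.unit : ℂˣ) : ℂ) else 0) ≠
        (haveI := locallyCompactSpace_cmBorelU L 3 v
         (Representation.twist
            (((Representation.trivial ℂ ↥(torusU (conjLocal L (IsCMField.complexConj L) v) (cmLocalForm L 3 v)) ℂ).twist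
              (cmTorusCharPair L v χ₁ 1)).comp (cmBorelTriple L 3 v).proj) (rootDeltaChar (cmBorelTriple L 3 v).P))
          ⟨r * b₀ * r⁻¹, hb₀P⟩ 1))
    (h1g : f.toFun w₀ = 0)
    {u : Gqs L v} (hu : (u : ↥(unitaryGroupOfForm (conjLocal L (IsCMField.complexConj L) v) (cmLocalForm L 3 v))) ∈ (cmBorelTriple L 3 v).N) (hJ : w₀ * u * w₀ ∉ Je) :
    f.toFun (w₀ * u * w₀) = 0 := by
  haveI := locallyCompactSpace_cmBorelU L 3 v
  have hσσ : ∀ y, (galAdicCompletionMap (L := L) (IsCMField.complexConj L) hw) ((galAdicCompletionMap (L := L) (IsCMField.complexConj L) hw) y) = y :=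
    galAdicCompletionMap_galAdicCompletionMap_of_smul_eq (IsCMField.complexConj L) w (IsCMField.complexConj_ne_one L) hw
  have hvσ : ∀ y, Valued.v (galAdicCompletionMap (L := L) (IsCMField.complexConj L) hw y) = Valued.v y :=
    fun y => valued_galAdicCompletionMap (L := L) (IsCMField.complexConj L) hw y
  by_cases hsharp : Valued.v ((((eA (w₀ * u * w₀) : ↥(unitaryGroupOfForm (galAdicCompletionMap (L := L) (IsCMField.complexConj L) hw) ((StdForm.antidiagonal 3).over (w.1.adicCompletion L)))) : GL (Fin 3) (w.1.adicCompletion L)) : Matrix (Fin 3) (Fin 3) (w.1.adicCompletion L)) 2 1 / (((eA (w₀ * u * w₀) : ↥(unitaryGroupOfForm (galAdicCompletionMap (L := L) (IsCMField.complexConj L) hw) ((StdForm.antidiagonal 3).over (w.1.adicCompletion L)))) : GL (Fin 3) (w.1.adicCompletion L)) : Matrix (Fin 3) (Fin 3) (w.1.adicCompletion L)) 2 0) ≤ Valued.v ϖ ^ r₁ ∧ (Valued.v ϖ ^ 0)⁻¹ ≤ Valued.v ((((eA (w₀ * u * w₀) : ↥(unitaryGroupOfForm (galAdicCompletionMap (L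 := L) (IsCMField.complexConj L) hw) ((StdForm.antidiagonal 3).over (w.1.adicCompletion L)))) : GL (Fin 3) (w.1.adicCompletion L)) : Matrix (Fin 3) (Fin 3) (w.1.adicCompletion L)) 2 0)
  · -- the sharp big cell: `w₀uw₀ = p′·w₀·u′`, `u′ ∈ J_e`
    obtain ⟨p', hp', u', hu', heq⟩ := K2E3LowerUnipotentDeepCellTwoDepth.exists_borel_mul_weylLongU_mul_mem_of_v_apply_div_le
      (galAdicCompletionMap (L := L) (IsCMField.complexConj L) hw) (rfl : (StdForm.antidiagonal 3).over (w.1.adicCompletion L) = _) hσσ hvσ hϖ _ Jg hJg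
      (fun i => by fin_cases i <;> rfl) (fun i j => by fin_cases i <;> fin_cases j <;> rfl)
      (map_mem_map_of_mem_map L v w hw eA heA (cmBorelTriple L 3 v) rfl w₀ hw₀ (conj_mem_map_conj L v w hw eA heA w₀ hw₀ hu)) hsharp.1 hsharp.2
    have heq' : w₀ * u * w₀ = eA.symm p' * w₀ * eA.symm u' := eA.injective (by
      rw [heq, map_mul, map_mul, ContinuousMulEquiv.apply_symm_apply, ContinuousMulEquiv.apply_symm_apply, map_weyl_eq_weylLongU L v w hw eA heA w₀ hw₀])
    have hp'P := symm_mem_P_of_mem_borelU L v w hw eA heA (cmBorelTriple L 3 v) rfl hp'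
    have hu'J : eA.symm u' ∈ Je := by
      rw [hJe, Subgroup.mem_comap]
      change eA (eA.symm u') ∈ Jg
      rw [ContinuousMulEquiv.apply_symm_apply]
      exact hu'
    have hcell := K2E3IwahoriPlaneTwoCells.toFun_mul_mul_eq_of_eigen (cmBorelTriple L 3 v).P _ Je
      (fun g : ↥(unitaryGroupOfForm (conjLocal L (IsCMField.complexConj L) v) (cmLocalForm L 3 v)) =>
        if h : IsUnit (((g : GL (Fin 3) (LocalRing L v)) : Matrix (Fin 3) (Fin 3) (LocalRing L v)) 0 0) then ((χ₁ h.unit : ℂˣ) : ℂ) else 0)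
      f heig (eA.symm p') hp'P w₀ (eA.symm u') hu'J
    rw [heq']
    exact hcell.trans (mul_eq_zero_of_right _ h1g)
  · -- `w₀uw₀ ∈ R`
    have hrR : ((w₀ * u * w₀ : Gqs L v) : ↥(unitaryGroupOfForm (conjLocal L (IsCMField.complexConj L) v) (cmLocalForm L 3 v))) ∈ R :=
      (hR _).2 ⟨conj_mem_map_conj L v w hw eA heA w₀ hw₀ hu, hJ, hsharp⟩
    exact BranchBDeterminantVanishingCells.toFun_eq_zero_of_mem_cells (cmBorelTriple L 3 v).P _ Je
      (fun g : ↥(unitaryGroupOfForm (conjLocal L (IsCMField.complexConj L) v) (cmLocalForm L 3 v)) =>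
        if h : IsUnit (((g : GL (Fin 3) (LocalRing L v)) : Matrix (Fin 3) (Fin 3) (LocalRing L v)) 0 0) then ((χ₁ h.unit : ℂˣ) : ℂ) else 0)
      R hwit f heig (w₀ * u * w₀) ⟨_, hrR, 1, ((cmBorelTriple L 3 v).P).one_mem, 1, Je.one_mem, by rw [one_mul, mul_one]⟩

end Summit.HodgeConjecture.HodgeConjecture.R90.S1.BposPairIntegrandsTwoDepth

end
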